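import Literature.NumberTheory.PAdicHodge.BmaxPlusBdRModFil
import HarnessLib

/-!
# The comparison `B_max⁺(F) → B_dR⁺(F)/Fil^k` is a ring homomorphism extending `ι : 𝔸_inf → B_dR⁺`

Topic `Literature/NumberTheory/PAdicHodge`; namespace `Literature.NumberTheory.PAdicHodge`. THEOREMS ONLY (no definition, no named
fact, no instance, no `sorry`). Sequel of `BmaxPlusBdRModFil` (`exists_bdR_lim_modFil`: for `x ∈ B_max⁺` and `k`, a limit `L ∈ B_dR⁺`
of the images `ι₀(x mod p^M)` modulo `Fil^k` for Fontaine's lattice topology, unique modulo `ξ^k`). Here: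

* `bdR_lim_modFil_of` / `bdR_lim_modFil_ainfToBmaxPlus` — on `B⁰_max` (resp. `𝔸_inf`) one may take `L = ι₀(y)` (resp. `ι(a)`):
  the comparison extends `B⁰_max ⊂ 𝔸_inf[1/p] → B_dR⁺`;
* `bdR_lim_modFil_add`, `bdR_lim_modFil_neg`, ★ `bdR_lim_modFil_mul` — limits add and multiply (multiplication by the bounded
  elements `L₁`, `ι₀(y₂)` is continuous for Fontaine's topology, `lattice_mul_of_bounded`), so that `x ↦ (L mod ξ^k)` is a RING
  HOMOMORPHISM `B_max⁺ → B_dR⁺/Fil^k` for every `k`, compatible in `k` (`bdR_lim_modFil_of_le`).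

Brick B5 (first half) of the φ-road of line `kato_lever` (crux K★ `stmt-BirchSwinnertonDyer-22226`, memo
`Cruxes/StarredOptimalManinUnitFiveSeven/Lines/kato-lever-K2-phi-road.md` §1). Infrastructure only: BSD / K★ are not proved by any of this.

## References
* [Colmez1998Annals] P. Colmez, *Théorie d'Iwasawa des représentations de de Rham d'un corps local*, Ann. of Math. 148 (1998), §III.2.
* [FontaineAsterisque223III] J.-M. Fontaine, *Le corps des périodes p-adiques*, Astérisque 223 (1994), Exp. II §1.5.3.
-/

noncomputable section

open WittVector Field ValuativeRel Polynomial Finset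
open Literature.AlgebraicGeometry.Resolution

namespace Literature.NumberTheory.PAdicHodge

open Literature.NumberTheory.GaloisRepresentations
open Literature.NumberTheory.GaloisRepresentations.IsNonarchimedeanLocalField

variable {F : Type} [Field F] [ValuativeRel F] [TopologicalSpace F] [IsNonarchimedeanLocalField F]
  [CharZero F] {p : ℕ} [Fact p.Prime] [Fact (¬ IsUnit (p : integerC F))]
  [IsAdicComplete (Ideal.span {(p : integerC F)}) (integerC F)]

omit [CharZero F] in
/-- `ι₀` as the ring map `(𝔸_inf[1/p] → B_dR⁺) ∘ val`. [folklore: unfolding] -/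
private theorem comp_val_apply' (y : bmaxZero F p) :
    ((algebraMap (Localization.Away (p : Ainf (p := p) F)) (BDeRhamPlus (integerC F) p)).comp (bmaxZero F p).val.toRingHom) y =
      algebraMap (Localization.Away (p : Ainf (p := p) F)) (BDeRhamPlus (integerC F) p) (y : Localization.Away (p : Ainf (p := p) F)) := rfl

omit [CharZero F] in
/-- `ι₀ ∘ (𝔸_inf → B⁰_max) = ι : 𝔸_inf → B_dR⁺`. [folklore: unfolding of the structure maps] -/
private theorem algebraMap_coe_algebraMap' (a : Ainf (p := p) F) :
    algebraMap (Localization.Away (p : Ainf (p := p) F)) (BDeRhamPlus (integerC F) p)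
        ((algebraMap (Ainf (p := p) F) (bmaxZero F p) a : bmaxZero F p) : Localization.Away (p : Ainf (p := p) F)) =
      ainfToBdR a := rfl

/-! ### §4 Values on `B⁰_max` and `𝔸_inf`; ring structure of the comparison -/

set_option maxHeartbeats 3200000 in
omit [CharZero F] in
/-- **On `B⁰_max` the comparison is `ι₀`**: for `x = y₀ ∈ B⁰_max`, `L := ι₀(y₀)` is a limit modulo every `Fil^k` (shift `0`).
[cite: Colmez1998Annals, §III.2] -/
theorem bdR_lim_modFil_of (y₀ : bmaxZero F p) (k : ℕ) :
    ∀ N M : ℕ, N + 0 ≤ M → ∀ y : bmaxZero F p,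
      AdicCompletion.evalₐ (Ideal.span {(p : bmaxZero F p)}) M
          (AdicCompletion.of (Ideal.span {(p : bmaxZero F p)}) (bmaxZero F p) y₀) = Ideal.Quotient.mk _ y →
      ∃ (a : Ainf (p := p) F) (w : BDeRhamPlus (integerC F) p),
        (p : BDeRhamPlus (integerC F) p) ^ k *
            (algebraMap (Localization.Away (p : Ainf (p := p) F)) (BDeRhamPlus (integerC F) p) (y₀ : Localization.Away (p : Ainf (p := p) F)) -
              algebraMap (Localization.Away (p : Ainf (p := p) F)) (BDeRhamPlus (integerC F) p) (y : Localization.Away (p : Ainf (p := p) F))) =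
          ainfToBdR ((p : Ainf (p := p) F) ^ N * a) + xiBdR ^ k * w := by
  intro N M hM y hy
  have h0 : AdicCompletion.evalₐ (Ideal.span {(p : bmaxZero F p)}) M
      (AdicCompletion.of (Ideal.span {(p : bmaxZero F p)}) (bmaxZero F p) y₀) = Ideal.Quotient.mk _ y₀ := AdicCompletion.evalₐ_of _ M _
  have hsub : y₀ - y ∈ Ideal.span {(p : bmaxZero F p)} ^ N :=
    Ideal.pow_le_pow_right (show N ≤ M by omega) (sub_mem_pow_of_evalₐ_eq le_rfl hy h0)
  obtain ⟨a, w, e⟩ := exists_natCast_pow_mul_algebraMap_coe_eq_of_mem_pow hsub k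
  exact ⟨a, w, by rw [← comp_val_apply', ← comp_val_apply', ← map_sub, comp_val_apply', e]⟩

set_option maxHeartbeats 3200000 in
omit [CharZero F] in
/-- **On `𝔸_inf` the comparison is `ι`**: for `x = ι(a₀)`, `L := ainfToBdR a₀` is a limit modulo every `Fil^k`.
[cite: Colmez1998Annals, §III.2] -/
theorem bdR_lim_modFil_ainfToBmaxPlus (a₀ : Ainf (p := p) F) (k : ℕ) :
    ∀ N M : ℕ, N + 0 ≤ M → ∀ y : bmaxZero F p,
      AdicCompletion.evalₐ (Ideal.span {(p : bmaxZero F p)}) M (ainfToBmaxPlus F p a₀) = Ideal.Quotient.mk _ y →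
      ∃ (a : Ainf (p := p) F) (w : BDeRhamPlus (integerC F) p),
        (p : BDeRhamPlus (integerC F) p) ^ k *
            (ainfToBdR a₀ -
              algebraMap (Localization.Away (p : Ainf (p := p) F)) (BDeRhamPlus (integerC F) p) (y : Localization.Away (p : Ainf (p := p) F))) =
          ainfToBdR ((p : Ainf (p := p) F) ^ N * a) + xiBdR ^ k * w := by
  rw [← algebraMap_coe_algebraMap' a₀, ainfToBmaxPlus_apply]
  exact bdR_lim_modFil_of (algebraMap (Ainf (p := p) F) (bmaxZero F p) a₀) k

set_option maxHeartbeats 3200000 in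
set_option synthInstance.maxHeartbeats 400000 in
omit [CharZero F] in
/-- **Additivity**: limits of `x₁`, `x₂` modulo `Fil^k` add to a limit of `x₁ + x₂`. [cite: FontaineAsterisque223III, Exp. II §1.5.3] -/
theorem bdR_lim_modFil_add {x₁ x₂ : BmaxPlus F p} {k : ℕ} {L₁ L₂ : BDeRhamPlus (integerC F) p} {r₁ r₂ : ℕ}
    (h₁ : ∀ N M : ℕ, N + r₁ ≤ M → ∀ y : bmaxZero F p,
      AdicCompletion.evalₐ (Ideal.span {(p : bmaxZero F p)}) M x₁ = Ideal.Quotient.mk _ y →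
      ∃ (a : Ainf (p := p) F) (w : BDeRhamPlus (integerC F) p),
        (p : BDeRhamPlus (integerC F) p) ^ k *
            (L₁ - algebraMap (Localization.Away (p : Ainf (p := p) F)) (BDeRhamPlus (integerC F) p)
              (y : Localization.Away (p : Ainf (p := p) F))) =
          ainfToBdR ((p : Ainf (p := p) F) ^ N * a) + xiBdR ^ k * w)
    (h₂ : ∀ N M : ℕ, N + r₂ ≤ M → ∀ y : bmaxZero F p,
      AdicCompletion.evalₐ (Ideal.span {(p : bmaxZero F p)}) M x₂ = Ideal.Quotient.mk _ y →
      ∃ (a : Ainf (p := p) F) (w : BDeRhamPlus (integerC F) p),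
        (p : BDeRhamPlus (integerC F) p) ^ k *
            (L₂ - algebraMap (Localization.Away (p : Ainf (p := p) F)) (BDeRhamPlus (integerC F) p)
              (y : Localization.Away (p : Ainf (p := p) F))) =
          ainfToBdR ((p : Ainf (p := p) F) ^ N * a) + xiBdR ^ k * w) :
    ∀ N M : ℕ, N + (r₁ + r₂) ≤ M → ∀ y : bmaxZero F p,
      AdicCompletion.evalₐ (Ideal.span {(p : bmaxZero F p)}) M (x₁ + x₂) = Ideal.Quotient.mk _ y →
      ∃ (a : Ainf (p := p) F) (w : BDeRhamPlus (integerC F) p),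
        (p : BDeRhamPlus (integerC F) p) ^ k *
            (L₁ + L₂ - algebraMap (Localization.Away (p : Ainf (p := p) F)) (BDeRhamPlus (integerC F) p)
              (y : Localization.Away (p : Ainf (p := p) F))) =
          ainfToBdR ((p : Ainf (p := p) F) ^ N * a) + xiBdR ^ k * w := by
  intro N M hM y hy
  obtain ⟨y₁, hy₁⟩ := Ideal.Quotient.mk_surjective (AdicCompletion.evalₐ (Ideal.span {(p : bmaxZero F p)}) M x₁)
  obtain ⟨y₂, hy₂⟩ := Ideal.Quotient.mk_surjective (AdicCompletion.evalₐ (Ideal.span {(p : bmaxZero F p)}) M x₂)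
  obtain ⟨a₁, w₁, e₁⟩ := h₁ N M (by omega) y₁ hy₁.symm
  obtain ⟨a₂, w₂, e₂⟩ := h₂ N M (by omega) y₂ hy₂.symm
  -- `y₁ + y₂ − y ∈ p^M B⁰_max ⊆ p^N B⁰_max`
  have hsum : AdicCompletion.evalₐ (Ideal.span {(p : bmaxZero F p)}) M (x₁ + x₂) = Ideal.Quotient.mk _ (y₁ + y₂) := by
    rw [map_add, map_add, hy₁, hy₂]
  have hsub : (y₁ + y₂) - y ∈ Ideal.span {(p : bmaxZero F p)} ^ N :=
    Ideal.pow_le_pow_right (show N ≤ M by omega) (sub_mem_pow_of_evalₐ_eq le_rfl hy hsum)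
  obtain ⟨a₃, w₃, e₃⟩ := exists_natCast_pow_mul_algebraMap_coe_eq_of_mem_pow hsub k
  refine ⟨a₁ + a₂ + a₃, w₁ + w₂ + w₃, ?_⟩
  have e0 : algebraMap (Localization.Away (p : Ainf (p := p) F)) (BDeRhamPlus (integerC F) p)
      ((y₁ + y₂ - y : bmaxZero F p) : Localization.Away (p : Ainf (p := p) F)) =
      algebraMap (Localization.Away (p : Ainf (p := p) F)) (BDeRhamPlus (integerC F) p) (y₁ : Localization.Away (p : Ainf (p := p) F)) +
        algebraMap (Localization.Away (p : Ainf (p := p) F)) (BDeRhamPlus (integerC F) p) (y₂ : Localization.Away (p : Ainf (p := p) F)) -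
        algebraMap (Localization.Away (p : Ainf (p := p) F)) (BDeRhamPlus (integerC F) p) (y : Localization.Away (p : Ainf (p := p) F)) := by
    rw [← comp_val_apply' (y₁ + y₂ - y), map_sub, map_add, comp_val_apply', comp_val_apply', comp_val_apply']
  rw [e0] at e₃
  simp only [map_add, map_mul, map_pow, map_natCast] at e₁ e₂ e₃ ⊢
  linear_combination e₁ + e₂ + e₃

set_option maxHeartbeats 3200000 in
set_option synthInstance.maxHeartbeats 400000 in
omit [CharZero F] in
/-- **Negation**: `−L` is a limit of `−x`. [cite: FontaineAsterisque223III, Exp. II §1.5.3] -/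
theorem bdR_lim_modFil_neg {x : BmaxPlus F p} {k : ℕ} {L : BDeRhamPlus (integerC F) p} {r : ℕ}
    (h : ∀ N M : ℕ, N + r ≤ M → ∀ y : bmaxZero F p,
      AdicCompletion.evalₐ (Ideal.span {(p : bmaxZero F p)}) M x = Ideal.Quotient.mk _ y →
      ∃ (a : Ainf (p := p) F) (w : BDeRhamPlus (integerC F) p),
        (p : BDeRhamPlus (integerC F) p) ^ k *
            (L - algebraMap (Localization.Away (p : Ainf (p := p) F)) (BDeRhamPlus (integerC F) p)
              (y : Localization.Away (p : Ainf (p := p) F))) =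
          ainfToBdR ((p : Ainf (p := p) F) ^ N * a) + xiBdR ^ k * w) :
    ∀ N M : ℕ, N + r ≤ M → ∀ y : bmaxZero F p,
      AdicCompletion.evalₐ (Ideal.span {(p : bmaxZero F p)}) M (-x) = Ideal.Quotient.mk _ y →
      ∃ (a : Ainf (p := p) F) (w : BDeRhamPlus (integerC F) p),
        (p : BDeRhamPlus (integerC F) p) ^ k *
            (-L - algebraMap (Localization.Away (p : Ainf (p := p) F)) (BDeRhamPlus (integerC F) p)
              (y : Localization.Away (p : Ainf (p := p) F))) =
          ainfToBdR ((p : Ainf (p := p) F) ^ N * a) + xiBdR ^ k * w := by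
  intro N M hM y hy
  have hy' : AdicCompletion.evalₐ (Ideal.span {(p : bmaxZero F p)}) M x = Ideal.Quotient.mk _ (-y) := by
    rw [map_neg, ← hy, map_neg, neg_neg]
  obtain ⟨a, w, e⟩ := h N M hM (-y) hy'
  refine ⟨-a, -w, ?_⟩
  have e0 : algebraMap (Localization.Away (p : Ainf (p := p) F)) (BDeRhamPlus (integerC F) p)
      ((-y : bmaxZero F p) : Localization.Away (p : Ainf (p := p) F)) =
      -algebraMap (Localization.Away (p : Ainf (p := p) F)) (BDeRhamPlus (integerC F) p) (y : Localization.Away (p : Ainf (p := p) F)) := by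
    rw [← comp_val_apply', map_neg, comp_val_apply']
  rw [e0] at e
  simp only [map_neg, map_mul, map_pow, map_natCast] at e ⊢
  linear_combination -e

set_option maxHeartbeats 3200000 in
set_option synthInstance.maxHeartbeats 400000 in
/-- ★ **Multiplicativity**: limits of `x₁`, `x₂` modulo `Fil^k` multiply to a limit of `x₁ x₂` (with a larger shift: multiplication by
the bounded elements `L₁` and `ι₀(y₂)` is continuous for Fontaine's topology, `lattice_mul_of_bounded`).
[cite: Colmez1998Annals, §III.2] [cite: FontaineAsterisque223III, Exp. II §1.5.3] -/
theorem bdR_lim_modFil_mul {x₁ x₂ : BmaxPlus F p} {k : ℕ} {L₁ L₂ : BDeRhamPlus (integerC F) p} {r₁ r₂ : ℕ}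
    (h₁ : ∀ N M : ℕ, N + r₁ ≤ M → ∀ y : bmaxZero F p,
      AdicCompletion.evalₐ (Ideal.span {(p : bmaxZero F p)}) M x₁ = Ideal.Quotient.mk _ y →
      ∃ (a : Ainf (p := p) F) (w : BDeRhamPlus (integerC F) p),
        (p : BDeRhamPlus (integerC F) p) ^ k *
            (L₁ - algebraMap (Localization.Away (p : Ainf (p := p) F)) (BDeRhamPlus (integerC F) p)
              (y : Localization.Away (p : Ainf (p := p) F))) =
          ainfToBdR ((p : Ainf (p := p) F) ^ N * a) + xiBdR ^ k * w)
    (h₂ : ∀ N M : ℕ, N + r₂ ≤ M → ∀ y : bmaxZero F p,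
      AdicCompletion.evalₐ (Ideal.span {(p : bmaxZero F p)}) M x₂ = Ideal.Quotient.mk _ y →
      ∃ (a : Ainf (p := p) F) (w : BDeRhamPlus (integerC F) p),
        (p : BDeRhamPlus (integerC F) p) ^ k *
            (L₂ - algebraMap (Localization.Away (p : Ainf (p := p) F)) (BDeRhamPlus (integerC F) p)
              (y : Localization.Away (p : Ainf (p := p) F))) =
          ainfToBdR ((p : Ainf (p := p) F) ^ N * a) + xiBdR ^ k * w) :
    ∃ r : ℕ, ∀ N M : ℕ, N + r ≤ M → ∀ y : bmaxZero F p,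
      AdicCompletion.evalₐ (Ideal.span {(p : bmaxZero F p)}) M (x₁ * x₂) = Ideal.Quotient.mk _ y →
      ∃ (a : Ainf (p := p) F) (w : BDeRhamPlus (integerC F) p),
        (p : BDeRhamPlus (integerC F) p) ^ k *
            (L₁ * L₂ - algebraMap (Localization.Away (p : Ainf (p := p) F)) (BDeRhamPlus (integerC F) p)
              (y : Localization.Away (p : Ainf (p := p) F))) =
          ainfToBdR ((p : Ainf (p := p) F) ^ N * a) + xiBdR ^ k * w := by
  -- `L₁` is bounded: `p^s L₁ ∈ ι(𝔸_inf) + ξ^k B_dR⁺`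
  obtain ⟨s, b₁, v₁, hb₁⟩ := GaloisContinuity.exists_natCast_pow_mul_eq_ainfToBdR_add L₁ k
  refine ⟨r₁ + r₂ + s + k, fun N M hM y hy => ?_⟩
  obtain ⟨y₁, hy₁⟩ := Ideal.Quotient.mk_surjective (AdicCompletion.evalₐ (Ideal.span {(p : bmaxZero F p)}) M x₁)
  obtain ⟨y₂, hy₂⟩ := Ideal.Quotient.mk_surjective (AdicCompletion.evalₐ (Ideal.span {(p : bmaxZero F p)}) M x₂)
  -- `p^k(L₁ − ι₀ y₁) ∈ Λ(N + k, k)`, `p^k(L₂ − ι₀ y₂) ∈ Λ(N + s, k)`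
  obtain ⟨a₁, w₁, e₁⟩ := h₁ (N + k) M (by omega) y₁ hy₁.symm
  obtain ⟨a₂, w₂, e₂⟩ := h₂ (N + s) M (by omega) y₂ hy₂.symm
  -- `ι₀(y₂)` is bounded with exponent `k`
  obtain ⟨b₂, v₂, hb₂⟩ := exists_natCast_pow_mul_algebraMap_coe_eq y₂ k
  -- the two products are in `Λ(N, k)`
  obtain ⟨c₁, u₁, f₁⟩ := GaloisContinuity.lattice_mul_of_bounded (N := N) hb₁ e₂
  obtain ⟨c₂, u₂, f₂⟩ := GaloisContinuity.lattice_mul_of_bounded (N := N) hb₂ e₁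
  -- representative change `y₁ y₂ − y ∈ p^M ⊆ p^N`
  have hprod : AdicCompletion.evalₐ (Ideal.span {(p : bmaxZero F p)}) M (x₁ * x₂) = Ideal.Quotient.mk _ (y₁ * y₂) := by
    rw [map_mul, map_mul, hy₁, hy₂]
  have hsub : y₁ * y₂ - y ∈ Ideal.span {(p : bmaxZero F p)} ^ N :=
    Ideal.pow_le_pow_right (show N ≤ M by omega) (sub_mem_pow_of_evalₐ_eq le_rfl hy hprod)
  obtain ⟨a₃, w₃, e₃⟩ := exists_natCast_pow_mul_algebraMap_coe_eq_of_mem_pow hsub k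
  refine ⟨c₁ + c₂ + a₃, u₁ + u₂ + w₃, ?_⟩
  have e0 : algebraMap (Localization.Away (p : Ainf (p := p) F)) (BDeRhamPlus (integerC F) p)
      ((y₁ * y₂ - y : bmaxZero F p) : Localization.Away (p : Ainf (p := p) F)) =
      algebraMap (Localization.Away (p : Ainf (p := p) F)) (BDeRhamPlus (integerC F) p) (y₁ : Localization.Away (p : Ainf (p := p) F)) *
        algebraMap (Localization.Away (p : Ainf (p := p) F)) (BDeRhamPlus (integerC F) p) (y₂ : Localization.Away (p : Ainf (p := p) F)) -
        algebraMap (Localization.Away (p : Ainf (p := p) F)) (BDeRhamPlus (integerC F) p) (y : Localization.Away (p : Ainf (p := p) F)) := by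
    rw [← comp_val_apply' (y₁ * y₂ - y), map_sub, map_mul, comp_val_apply', comp_val_apply', comp_val_apply']
  rw [e0] at e₃
  simp only [map_add, map_mul, map_pow, map_natCast] at f₁ f₂ e₃ ⊢
  -- algebra: `p^k(L₁L₂ − ι₀ y) = L₁·p^k(L₂ − ι₀y₂) + ι₀(y₂)·p^k(L₁ − ι₀y₁) + p^k ι₀(y₁y₂ − y)`
  linear_combination f₁ + f₂ + e₃

end Literature.NumberTheory.PAdicHodge

end
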